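import Literature.Probability.RandomPlanarGeometry.HexParafermion
import Literature.Probability.RandomPlanarGeometry.HexSAW
import HarnessLib

/-!
# Crux `SAWDevelopingMap.ObservableToSLE` (stmt-CriticalPhenomena-10472), line
`floor-ratio-restriction-bootstrap`: the dictionary for `stub_canonicalTransfer`, sandwich bounds

Landing target:
`Summits/CriticalPhenomena/SAWScalingLimit/Theorems/SAWDevelopingMapObservableToSLECanonicalTransferSandwich.lean`
(`--supports stmt-CriticalPhenomena-10472`).  Sequel of `…CanonicalTransferDictionary.lean`
(whose walk-space bijections are repeated here as private local copies, to keep this file's imports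
in `Literature`).

For a general Jordan floor domain the canonical discrete domain `Ω_δ` is NOT an admissible vertex
domain (honeycomb edges between vertices of `Ω_δ` whose segment leaves `cl Ω`, microscopic holes),
so the exact identity `stub_canonicalTransfer_fixedScale` must be replaced by a sandwich
`Z_{Λ^{in}} ≤ Z^{can} ≤ Z_{Λ^{out}}` between an inner admissible domain without bad edges and an
outer vertex set containing `Ω_δ`; combined with the boundary-insensitivity principle
(`…CanonicalTransferInsensitivity.lean`: `Z_{Λ'}/Z_Λ → 1` for nested admissible families of one
floor domain) this squeezes the canonical probabilities.  This file proves the fixed-scale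
comparisons (injections of walk spaces preserving the vertex list):

* `sum_pow_length_le_sum_pow_vertexCount` (inner bound `Z_Λ ≤ Z^{can}`: all honeycomb edges inside
  `Λ` are edges of `Ω_δ`), `sum_pow_vertexCount_le_sum_pow_length` (outer bound `Z^{can} ≤ Z_V`:
  `V` contains every vertex carrying an edge of `Ω_δ`);
* `sum_filter_meshEvent_pow_vertexCount_le` — the outer bound for the walks of the event of
  `stub_canonicalTransfer` (numerator);
* `stub_canonicalTransfer_sandwich` — the registered sub-goal: both bounds for the canonical
  critical mass `Σ_{γ : SAW of Ω_δ, a → b} x_c^{#vertices}`.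
-/

noncomputable section

open scoped BigOperators Classical ENNReal
open MeasureTheory
open Literature.Probability.LatticeModels (HexVertex hexGraph hexCenter)
open Literature.Probability.RandomPlanarGeometry
open Literature.Probability.RandomPlanarGeometry.SAW

namespace Summit.CriticalPhenomena.SAWScalingLimit.Theorems.ObservableToSLE.FloorRatio

/-! ### Local copies of the dictionary bijections -/

section LocalCopies

variable {Λ : Finset HexVertex} {va ua vb ub : HexVertex}

/-- Local copy of `eq_of_mem_sym2_of_mem` (`…CanonicalTransferDictionary.lean`), kept private. [folklore] -/
private theorem eq_of_mem_sym2_of_mem_loc {v u w : HexVertex} (hu : u ∉ Λ) (hw : w ∈ Λ)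
    (h : w ∈ s(v, u)) : w = v := by
  rcases Sym2.mem_iff.1 h with rfl | rfl
  · rfl
  · exact absurd hw hu

/-- Local copy of `exists_equiv_isPath_hexMidEdgeSAW` (`…CanonicalTransferDictionary.lean`), kept private. [folklore] -/
private theorem exists_equiv_isPath_hexMidEdgeSAW_loc (hva : va ∈ Λ) (hua : ua ∉ Λ) (hub : ub ∉ Λ)
    (ha : hexGraph.Adj va ua) (hne : s(va, ua) ≠ s(vb, ub)) :
    ∃ e : {p : hexGraph.Walk va vb // p.IsPath ∧ ∀ w ∈ p.support, w ∈ Λ} ≃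
        HexMidEdgeSAW Λ s(va, ua) s(vb, ub), ∀ p, (e p).verts = p.1.support := by
  -- the forward map: a path is the mid-edge walk with the same vertex list
  let F : {p : hexGraph.Walk va vb // p.IsPath ∧ ∀ w ∈ p.support, w ∈ Λ} →
      HexMidEdgeSAW Λ s(va, ua) s(vb, ub) := fun p =>
    { verts := p.1.support
      subset := p.2.2
      nodup := p.2.1.support_nodup
      isChain := p.1.isChain_adj_support
      head_mem := fun v hv => by
        rw [List.head?_eq_some_iff] at hv
        obtain ⟨l, hl⟩ := hv
        have : p.1.support.head p.1.support_ne_nil = v := by simp [hl]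
        rw [SimpleGraph.Walk.head_support] at this
        exact this ▸ Sym2.mem_mk_left _ _
      getLast_mem := fun v hv => by
        rw [List.getLast?_eq_some_getLast p.1.support_ne_nil, Option.some_inj,
          SimpleGraph.Walk.getLast_support] at hv
        exact hv ▸ Sym2.mem_mk_left _ _
      eq_of_nil := fun h => absurd h p.1.support_ne_nil
      edges_nodup := fun _ => by
        rw [← SimpleGraph.Walk.edges_eq_zipWith_support, List.cons_append, List.nodup_cons,
          List.mem_append, List.mem_singleton, not_or]
        refine ⟨⟨fun h => hua (p.2.2 _ (p.1.snd_mem_support_of_mem_edges h)), hne⟩, ?_⟩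
        rw [List.nodup_append]
        refine ⟨p.2.1.isTrail.edges_nodup, List.nodup_singleton _, ?_⟩
        rintro e he _ h rfl
        rw [List.mem_singleton] at h
        subst h
        exact hub (p.2.2 _ (p.1.snd_mem_support_of_mem_edges he))
      fst_mem := ⟨(SimpleGraph.mem_edgeSet hexGraph).2 ha, va, Sym2.mem_mk_left _ _, hva⟩ }
  have hF : ∀ p, (F p).verts = p.1.support := fun _ => rfl
  have hinj : Function.Injective F := fun p q h =>
    Subtype.ext (SimpleGraph.Walk.ext_support (by rw [← hF, ← hF, h]))
  have hsurj : Function.Surjective F := by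
    intro γ
    have hne' : γ.verts ≠ [] := fun h => hne (γ.eq_of_nil h)
    have hhead : γ.verts.head hne' = va :=
      eq_of_mem_sym2_of_mem_loc hua (γ.subset _ (List.head_mem hne'))
        (γ.head_mem _ (List.head?_eq_some_head hne'))
    have hlast : γ.verts.getLast hne' = vb :=
      eq_of_mem_sym2_of_mem_loc hub (γ.subset _ (List.getLast_mem hne'))
        (γ.getLast_mem _ (List.getLast?_eq_some_getLast hne'))
    let p : hexGraph.Walk va vb :=
      (SimpleGraph.Walk.ofSupport γ.verts hne' γ.isChain).copy hhead hlast
    have hp : p.support = γ.verts := by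
      simp only [p, SimpleGraph.Walk.support_copy, SimpleGraph.Walk.support_ofSupport]
    refine ⟨⟨p, (SimpleGraph.Walk.isPath_def p).2 (hp ▸ γ.nodup), fun w hw => γ.subset w (hp ▸ hw)⟩,
      HexMidEdgeSAW.ext ?_⟩
    rw [hF, hp]
  exact ⟨Equiv.ofBijective F ⟨hinj, hsurj⟩, fun p => hF p⟩


variable {V : Type*} {G G' : SimpleGraph V}

/-- Local copy of `exists_equiv_isPath_of_le` (`…CanonicalTransferDictionary.lean`), kept private. [folklore] -/
private theorem exists_equiv_isPath_of_le_loc (hle : G' ≤ G) {Λ : Set V}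
    (hΛ : ∀ v ∈ Λ, ∀ w ∈ Λ, G.Adj v w → G'.Adj v w) (u v : V) :
    ∃ e : {p : G'.Walk u v // p.IsPath ∧ ∀ w ∈ p.support, w ∈ Λ} ≃
        {p : G.Walk u v // p.IsPath ∧ ∀ w ∈ p.support, w ∈ Λ},
      ∀ p, (e p).1.support = p.1.support := by
  have hedges : ∀ p : {p : G.Walk u v // p.IsPath ∧ ∀ w ∈ p.support, w ∈ Λ},
      ∀ e ∈ p.1.edges, e ∈ G'.edgeSet := by
    rintro p e he
    induction e using Sym2.ind with
    | h x y =>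
      exact hΛ x (p.2.2 _ (p.1.fst_mem_support_of_mem_edges he)) y
        (p.2.2 _ (p.1.snd_mem_support_of_mem_edges he)) (p.1.adj_of_mem_edges he)
  refine ⟨{ toFun := fun p => ⟨p.1.mapLe hle, (SimpleGraph.Walk.isPath_mapLe hle).2 p.2.1,
              fun w hw => p.2.2 w ?_⟩
            invFun := fun p => ⟨p.1.transfer G' (hedges p), p.2.1.transfer _,
              fun w hw => p.2.2 w ?_⟩
            left_inv := fun p => Subtype.ext (SimpleGraph.Walk.ext_support ?_)
            right_inv := fun p => Subtype.ext (SimpleGraph.Walk.ext_support ?_) },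
    fun p => SimpleGraph.Walk.support_mapLe_eq_support hle p.1⟩
  · rwa [SimpleGraph.Walk.support_mapLe_eq_support] at hw
  · rwa [SimpleGraph.Walk.support_transfer] at hw
  · rw [SimpleGraph.Walk.support_transfer, SimpleGraph.Walk.support_mapLe_eq_support]
  · rw [SimpleGraph.Walk.support_mapLe_eq_support, SimpleGraph.Walk.support_transfer]

/-- Local copy of `exists_equiv_embDomainSAW_isPath` (`…CanonicalTransferDictionary.lean`), kept private. [folklore] -/
private theorem exists_equiv_embDomainSAW_isPath_loc {emb : V → ℂ} {Ω : Set ℂ} {δ : ℝ} {Λ : Set V} {a : V}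
    (hΛ : ∀ v w, (embDomainGraph G emb Ω δ).Adj v w → v ∈ Λ) (ha : a ∈ Λ) (b : V) :
    ∃ e : EmbDomainSAW G emb Ω δ a b ≃
        {p : (embDomainGraph G emb Ω δ).Walk a b // p.IsPath ∧ ∀ w ∈ p.support, w ∈ Λ},
      ∀ γ, (e γ).1 = γ.walk := by
  have hsupp : ∀ γ : EmbDomainSAW G emb Ω δ a b, ∀ w ∈ γ.walk.support, w ∈ Λ := by
    intro γ w hw
    rw [← γ.walk.cons_tail_support, List.mem_cons] at hw
    rcases hw with rfl | hw
    · exact ha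
    · rw [← SimpleGraph.Walk.map_snd_darts] at hw
      obtain ⟨d, -, rfl⟩ := List.mem_map.1 hw
      exact hΛ _ _ d.adj.symm
  exact ⟨{ toFun := fun γ => ⟨γ.walk, γ.isPath, hsupp γ⟩
           invFun := fun p => ⟨p.1, p.2.1⟩
           left_inv := fun γ => rfl
           right_inv := fun p => rfl }, fun γ => rfl⟩

end LocalCopies

/-! ### One-sided comparisons (for sandwich arguments with bad edges) -/

section Sandwich

variable {Ω : Set ℂ} {δ : ℝ} {Λ : Finset HexVertex} {a b ua ub : HexVertex}

/-- **Inner bound `Z_Λ ≤ Z^{can}`.**  If every honeycomb edge between vertices of `Λ` is an edge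
of `Ω_δ`, the mid-edge walks `s_a → s_b` in `Λ` (`s_a = {a,u_a} ≠ s_b = {b,u_b}` boundary
mid-edges) inject, with `verts = support`, into the canonical self-avoiding walks `a → b` of
`Ω_δ`; hence for `x ≥ 0`, `Σ_{γ ⊂ Λ} x^{ℓ(γ)} ≤ Σ_{γ : SAW of Ω_δ, a → b} x^{#vertices(γ)}`.
[cite: LawlerSchrammWerner2004SAW, §3.4 ("SAW satisfies restriction")] -/
theorem sum_pow_length_le_sum_pow_vertexCount [Fintype (HexDomainSAW Ω δ a b)]
    (hΛ : ∀ v ∈ Λ, ∀ w ∈ Λ, hexGraph.Adj v w → (hexDomainGraph Ω δ).Adj v w)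
    (ha : a ∈ Λ) (hua : ua ∉ Λ) (hub : ub ∉ Λ) (hadj : hexGraph.Adj a ua)
    (hne : s(a, ua) ≠ s(b, ub)) {x : ℝ} (hx : 0 ≤ x) :
    ∑ γ : HexMidEdgeSAW Λ s(a, ua) s(b, ub), x ^ γ.length ≤
      ∑ γ : HexDomainSAW Ω δ a b, x ^ γ.vertexCount := by
  obtain ⟨e₂, he₂⟩ := exists_equiv_isPath_of_le_loc (embDomainGraph_le hexGraph hexCenter Ω δ)
    (Λ := (↑Λ : Set HexVertex)) (fun v hv w hw h => hΛ v hv w hw h) a b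
  obtain ⟨e₃, he₃⟩ := exists_equiv_isPath_hexMidEdgeSAW_loc (vb := b) ha hua hub hadj hne
  -- the injection `ι = forget ∘ e₂⁻¹ ∘ e₃⁻¹`
  let ι : HexMidEdgeSAW Λ s(a, ua) s(b, ub) → HexDomainSAW Ω δ a b := fun γ =>
    ⟨(e₂.symm (e₃.symm γ)).1, (e₂.symm (e₃.symm γ)).2.1⟩
  have hι : ∀ γ, (ι γ).walk.support = γ.verts := fun γ => by
    have h3 := he₃ (e₃.symm γ)
    rw [Equiv.apply_symm_apply] at h3
    have h2 := he₂ (e₂.symm (e₃.symm γ))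
    rw [Equiv.apply_symm_apply] at h2
    rw [h3, h2]
  have hinj : Function.Injective ι := fun γ₁ γ₂ h =>
    HexMidEdgeSAW.ext (by rw [← hι, ← hι, h])
  have hlen : ∀ γ, (ι γ).vertexCount = γ.length := fun γ => by
    rw [HexMidEdgeSAW.length, ← hι, SimpleGraph.Walk.length_support]
    rfl
  calc ∑ γ : HexMidEdgeSAW Λ s(a, ua) s(b, ub), x ^ γ.length
      = ∑ γ : HexMidEdgeSAW Λ s(a, ua) s(b, ub), x ^ (ι γ).vertexCount :=
        Fintype.sum_congr _ _ fun γ => by rw [hlen]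
    _ = ∑ γ ∈ Finset.univ.map ⟨ι, hinj⟩, x ^ γ.vertexCount := by
        rw [Finset.sum_map]; rfl
    _ ≤ ∑ γ : HexDomainSAW Ω δ a b, x ^ γ.vertexCount :=
        Finset.sum_le_sum_of_subset_of_nonneg (Finset.subset_univ _)
          fun γ _ _ => pow_nonneg hx _

/-- **Outer bound `Z^{can} ≤ Z_V`.**  If every vertex carrying an edge of `Ω_δ` lies in the
finite vertex set `V` (e.g. `V ⊇ Ω_δ`, no condition on the edges), the canonical self-avoiding
walks `a → b` of `Ω_δ` inject, with `support = verts`, into the mid-edge walks `s_a → s_b` in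
`V`; hence for `x ≥ 0`, `Σ_{γ : SAW of Ω_δ, a → b} x^{#vertices(γ)} ≤ Σ_{γ ⊂ V} x^{ℓ(γ)}`.
[cite: LawlerSchrammWerner2004SAW, §3.4 ("SAW satisfies restriction")] -/
theorem sum_pow_vertexCount_le_sum_pow_length {V : Finset HexVertex}
    [Fintype (HexDomainSAW Ω δ a b)] (hV : ∀ v w, (hexDomainGraph Ω δ).Adj v w → v ∈ V)
    (ha : a ∈ V) (hua : ua ∉ V) (hub : ub ∉ V) (hadj : hexGraph.Adj a ua)
    (hne : s(a, ua) ≠ s(b, ub)) {x : ℝ} (hx : 0 ≤ x) :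
    ∑ γ : HexDomainSAW Ω δ a b, x ^ γ.vertexCount ≤
      ∑ γ : HexMidEdgeSAW V s(a, ua) s(b, ub), x ^ γ.length := by
  obtain ⟨e₁, he₁⟩ := exists_equiv_embDomainSAW_isPath_loc (G := hexGraph) (emb := hexCenter)
    (Ω := Ω) (δ := δ) (Λ := (↑V : Set HexVertex)) (fun v w h => hV v w h) ha b
  obtain ⟨e₃, he₃⟩ := exists_equiv_isPath_hexMidEdgeSAW_loc (vb := b) ha hua hub hadj hne
  -- the injection `ι = e₃ ∘ mapLe ∘ e₁`
  let ι : HexDomainSAW Ω δ a b → HexMidEdgeSAW V s(a, ua) s(b, ub) := fun γ =>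
    e₃ ⟨(e₁ γ).1.mapLe (embDomainGraph_le hexGraph hexCenter Ω δ),
      (SimpleGraph.Walk.isPath_mapLe _).2 (e₁ γ).2.1, fun w hw => (e₁ γ).2.2 w
        (by rwa [SimpleGraph.Walk.support_mapLe_eq_support] at hw)⟩
  have hι : ∀ γ, (ι γ).verts = γ.walk.support := fun γ => by
    simp only [ι, he₃, SimpleGraph.Walk.support_mapLe_eq_support, he₁]
  have hinj : Function.Injective ι := by
    intro γ₁ γ₂ h
    have h' : γ₁.walk.support = γ₂.walk.support := by rw [← hι, ← hι, h]
    obtain ⟨w₁, hw₁⟩ := γ₁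
    obtain ⟨w₂, hw₂⟩ := γ₂
    obtain rfl : w₁ = w₂ := SimpleGraph.Walk.ext_support h'
    rfl
  have hlen : ∀ γ, (ι γ).length = γ.vertexCount := fun γ => by
    rw [HexMidEdgeSAW.length, hι, SimpleGraph.Walk.length_support]
    rfl
  calc ∑ γ : HexDomainSAW Ω δ a b, x ^ γ.vertexCount
      = ∑ γ : HexDomainSAW Ω δ a b, x ^ (ι γ).length :=
        Fintype.sum_congr _ _ fun γ => by rw [hlen]
    _ = ∑ γ ∈ Finset.univ.map ⟨ι, hinj⟩, x ^ γ.length := by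
        rw [Finset.sum_map]; rfl
    _ ≤ ∑ γ : HexMidEdgeSAW V s(a, ua) s(b, ub), x ^ γ.length :=
        Finset.sum_le_sum_of_subset_of_nonneg (Finset.subset_univ _)
          fun γ _ _ => pow_nonneg hx _

end Sandwich


/-! ### The outer bound restricted to the event "the walk stays in the `Ω'`-mesh" -/

section EventBound

variable {Ω Ω' : Set ℂ} {δ : ℝ} {a b ua ub : HexVertex}

/-- **Outer bound for the numerator.**  If every vertex carrying an edge of `Ω_δ` and lying in
`Ω'` belongs to the finite vertex set `V'` (`a ∈ V'`, `u_a, u_b ∉ V'`), the canonical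
self-avoiding walks `a → b` of `Ω_δ` that STAY IN THE `Ω'`-MESH (the event of
`stub_canonicalTransfer`) inject, with `support = verts`, into the mid-edge walks
`{a,u_a} → {b,u_b}` in `V'`; hence their `x`-mass is at most `Z_{V'}` (`x ≥ 0`).
[cite: LawlerSchrammWerner2004SAW, §3.4 ("SAW satisfies restriction")] -/
theorem sum_filter_meshEvent_pow_vertexCount_le {V' : Finset HexVertex}
    [Fintype (HexDomainSAW Ω δ a b)]
    (hV' : ∀ v w, (hexDomainGraph Ω δ).Adj v w → v ∈ embMeshVertices hexCenter Ω' δ → v ∈ V')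
    (ha : a ∈ V') (hua : ua ∉ V') (hub : ub ∉ V') (hadj : hexGraph.Adj a ua)
    (hne : s(a, ua) ≠ s(b, ub)) {x : ℝ} (hx : 0 ≤ x) :
    (∑ γ ∈ Finset.univ.filter (· ∈ {γ : HexDomainSAW Ω δ a b |
        (∀ v ∈ γ.walk.support, v ∈ embMeshVertices hexCenter Ω' δ) ∧
          ∀ e ∈ γ.walk.darts, (embMeshGraph hexGraph hexCenter Ω' δ).Adj e.fst e.snd}),
        x ^ γ.vertexCount) ≤
      ∑ γ : HexMidEdgeSAW V' s(a, ua) s(b, ub), x ^ γ.length := by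
  set S := Finset.univ.filter (· ∈ {γ : HexDomainSAW Ω δ a b |
        (∀ v ∈ γ.walk.support, v ∈ embMeshVertices hexCenter Ω' δ) ∧
          ∀ e ∈ γ.walk.darts, (embMeshGraph hexGraph hexCenter Ω' δ).Adj e.fst e.snd}) with hS
  obtain ⟨e₃, he₃⟩ := exists_equiv_isPath_hexMidEdgeSAW_loc (vb := b) ha hua hub hadj hne
  -- walks of the event stay in `V'`
  have hsupp : ∀ γ : ↥S, ∀ w ∈ (γ.1.walk.mapLe (embDomainGraph_le hexGraph hexCenter Ω δ)).support,
      w ∈ V' := by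
    rintro ⟨γ, hγ⟩ w hw
    rw [SimpleGraph.Walk.support_mapLe_eq_support] at hw
    rw [hS, Finset.mem_filter, Set.mem_setOf_eq] at hγ
    have hwΩ' := hγ.2.1 w hw
    rw [← γ.walk.cons_tail_support, List.mem_cons] at hw
    rcases hw with rfl | hw
    · exact ha
    · rw [← SimpleGraph.Walk.map_snd_darts] at hw
      obtain ⟨d, -, rfl⟩ := List.mem_map.1 hw
      exact hV' _ _ d.adj.symm hwΩ'
  let ι : ↥S → HexMidEdgeSAW V' s(a, ua) s(b, ub) := fun γ =>
    e₃ ⟨γ.1.walk.mapLe (embDomainGraph_le hexGraph hexCenter Ω δ),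
      (SimpleGraph.Walk.isPath_mapLe _).2 γ.1.isPath, hsupp γ⟩
  have hι : ∀ γ, (ι γ).verts = γ.1.walk.support := fun γ => by
    simp only [ι, he₃, SimpleGraph.Walk.support_mapLe_eq_support]
  have hinj : Function.Injective ι := by
    intro γ₁ γ₂ h
    have h' : γ₁.1.walk.support = γ₂.1.walk.support := by rw [← hι, ← hι, h]
    obtain ⟨⟨w₁, hw₁⟩, h₁⟩ := γ₁
    obtain ⟨⟨w₂, hw₂⟩, h₂⟩ := γ₂
    obtain rfl : w₁ = w₂ := SimpleGraph.Walk.ext_support h'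
    rfl
  have hlen : ∀ γ, (ι γ).length = γ.1.vertexCount := fun γ => by
    rw [HexMidEdgeSAW.length, hι, SimpleGraph.Walk.length_support]
    rfl
  calc ∑ γ ∈ S, x ^ γ.vertexCount
      = ∑ γ : ↥S, x ^ (ι γ).length := by
        rw [← Finset.sum_coe_sort]
        exact Fintype.sum_congr _ _ fun γ => by rw [hlen]
    _ = ∑ γ ∈ Finset.univ.map ⟨ι, hinj⟩, x ^ γ.length := by
        rw [Finset.sum_map]; rfl
    _ ≤ ∑ γ : HexMidEdgeSAW V' s(a, ua) s(b, ub), x ^ γ.length :=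
        Finset.sum_le_sum_of_subset_of_nonneg (Finset.subset_univ _)
          fun γ _ _ => pow_nonneg hx _

end EventBound

/-! ### Registered form: the sandwich (sub-goal of `stub_canonicalTransfer`) -/

/-- **Registered sub-goal `stub_canonicalTransfer_sandwich`** (crux item stmt-CriticalPhenomena-10472,
line `floor-ratio-restriction-bootstrap`, stub `stub_canonicalTransfer`): THE FIXED-SCALE
SANDWICH for the canonical critical mass.  For finite vertex sets `Λ ⊆ V` with `a ∈ Λ`,
`u_a, u_b ∉ V`, `s_a = {a, u_a} ≠ s_b = {b, u_b}`, such that every honeycomb edge inside `Λ` is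
an edge of `Ω_δ` (inner domain without bad edges) and every vertex carrying an edge of `Ω_δ` lies
in `V` (outer vertex set), `Z_Λ(s_a,s_b) ≤ Σ_{γ : SAW of Ω_δ, a → b} x_c^{#vertices(γ)} ≤ Z_V(s_a,s_b)`
(for any `Fintype` structure on the canonical walks, e.g. from `finite_hexDomainSAW` for bounded
`Ω`).
[cite: LawlerSchrammWerner2004SAW, §3.4 ("SAW satisfies restriction")] -/
theorem stub_canonicalTransfer_sandwich :
    ∀ (Ω : Set ℂ) (δ : ℝ) (Λ V : Finset HexVertex) (a b ua ub : HexVertex)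
    [Fintype (HexDomainSAW Ω δ a b)],
    (∀ v ∈ Λ, ∀ w ∈ Λ, hexGraph.Adj v w → (hexDomainGraph Ω δ).Adj v w) →
    (∀ v w : HexVertex, (hexDomainGraph Ω δ).Adj v w → v ∈ V) → Λ ⊆ V →
    a ∈ Λ → ua ∉ V → ub ∉ V → hexGraph.Adj a ua → s(a, ua) ≠ s(b, ub) →
    ∑ γ : HexMidEdgeSAW Λ s(a, ua) s(b, ub), hexCriticalFugacity ^ γ.length ≤
        ∑ γ : HexDomainSAW Ω δ a b, hexCriticalFugacity ^ γ.vertexCount ∧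
      ∑ γ : HexDomainSAW Ω δ a b, hexCriticalFugacity ^ γ.vertexCount ≤
        ∑ γ : HexMidEdgeSAW V s(a, ua) s(b, ub), hexCriticalFugacity ^ γ.length :=
  by
  intro _ _ _ _ _ _ _ _ _ hΛ hV hΛV ha hua hub hadj hne
  exact ⟨sum_pow_length_le_sum_pow_vertexCount hΛ ha (fun h => hua (hΛV h))
      (fun h => hub (hΛV h)) hadj hne hexCriticalFugacity_pos_lt_one.1.le,
    sum_pow_vertexCount_le_sum_pow_length hV (hΛV ha) hua hub hadj hne
      hexCriticalFugacity_pos_lt_one.1.le⟩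

end Summit.CriticalPhenomena.SAWScalingLimit.Theorems.ObservableToSLE.FloorRatio

end
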